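import Literature.NumberTheory.Sieve.ChenShifted
import Literature.NumberTheory.Sieve.ChenSiftedLower
import Literature.NumberTheory.Sieve.ChenTwinSieveUpperSum
import HarnessLib

/-!
# Chen's Theorem II: the shifted sifted sequence `{p + h : h < p ≤ x}` as a `SieveSequence`

Topic `Literature/NumberTheory/Sieve`; companion of `ChenShifted` (the set-up of Chen's Theorem II,
Chen Jing-run, Sci. Sinica 16 (1973), Thm II, at Chen's parameters) and of `ChenShiftedAssembly`
(which assembles Theorem II from three sieve estimates for `𝒜_h(x) = {p + h : p ≤ x}`). To prove those
estimates with the linear sieve of the tree (Iwaniec's Theorem 1 for `κ = 1`, uniform in the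
sequence, as in `ChenSiftedLower` / `ChenTheoremISiftedLower` for the Goldbach sequence `{x − p}`),
this file packages the shifted set as a `Literature.NumberTheory.Sieve.SieveSequence` and identifies
the sieve objects, exactly as `ChenSiftedLower` does for `chenGoldbachSeq`:

* `shiftSieveSet' h x = {p + h : h < p ≤ x}` (the primes `p ≤ h` are dropped, so that every element
  is coprime to `h`; `shiftSieveSet' ⊆ shiftSieveSet`), `chenShiftSeq h x` (weights `1_{𝒜'}`, density
  `shiftedPrimesDensity h`: `g(d) = 1/φ(d)` for `(d, h) = 1`, else `0`; size `X = π(x)`);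
* PROVED: `sifted_chenShiftSeq` (`S(𝒜', P(z); x + h) = roughCount (shiftSieveSet' h x) ⌈z⌉`),
  `densityProduct_chenShiftSeq` (`V(P(z)) = sieveProduct h z = V_h(z)`),
  `hasIwaniecDimension_chenShiftSeq` (dimension `Ω(1, L₀)` for even `h`: the density is
  that of `chenGoldbachSeq h`, `hasIwaniecDimension_chenGoldbachSeq`), and the remainder estimate
  `abs_remainder_chenShiftSeq_le`: `|r(d)| ≤ |π(x; d, −h) − π(x)/φ(d)| + (h + 1)` for `(d, h) = 1`
  (and `r(d) = 0` otherwise), summed in `remainderSum_chenShiftSeq_le` into the Bombieri–Vinogradov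
  sum `∑_{d ≤ D} |δ(x; d, −h)| + D(h + 1)`.

No named facts. (Chen, p. 176 of the original: Theorem II is proved "by the same method as used in
estimating `P_x(1,2)`"; this file is the dictionary `x − p ↦ p + h` for that method.)

## References

* Chen Jing-run, Sci. Sinica 16 (1973) 157–176, Theorem II and §III (reprint: Wang Yuan (ed.),
  *Goldbach Conjecture*, 1984, PDF pp. 150, 168). [ChenSciSinica1973]
* M. B. Nathanson, *Additive Number Theory: The Classical Bases*, GTM 164 (1996), §10.3–10.4.
  [Nathanson1996]
-/

open Finset Filter

noncomputable section

namespace Literature.NumberTheory.Sieve.Chen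

open ChenSieve SieveSequence

/-! ### The set `𝒜'_h(x) = {p + h : h < p ≤ x}` -/

/-- `𝒜'_h(x) = {p + h : p prime, h < p ≤ x}` — the part of `𝒜_h(x)` (`shiftSieveSet`) coprime to `h`.
[cite: ChenSciSinica1973, §I and Theorem II (reprint p. 150)] -/
def shiftSieveSet' (h x : ℕ) : Finset ℕ :=
  ((Finset.Ioc h x).filter Nat.Prime).map (addRightEmbedding h)

/-- Membership in `𝒜'_h(x)`. [folklore] -/
theorem mem_shiftSieveSet' {h x n : ℕ} :
    n ∈ shiftSieveSet' h x ↔ ∃ p : ℕ, p.Prime ∧ h < p ∧ p ≤ x ∧ p + h = n := by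
  simp only [shiftSieveSet', Finset.mem_map, Finset.mem_filter, Finset.mem_Ioc,
    addRightEmbedding_apply]
  constructor
  · rintro ⟨p, ⟨⟨h1, h2⟩, hp⟩, rfl⟩
    exact ⟨p, hp, h1, h2, rfl⟩
  · rintro ⟨p, hp, h1, h2, rfl⟩
    exact ⟨p, ⟨⟨h1, h2⟩, hp⟩, rfl⟩

/-- `𝒜'_h(x) ⊆ 𝒜_h(x)`. [folklore] -/
theorem shiftSieveSet'_subset (h x : ℕ) : shiftSieveSet' h x ⊆ shiftSieveSet h x := by
  intro n hn
  obtain ⟨p, hp, -, hpx, rfl⟩ := mem_shiftSieveSet'.mp hn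
  exact mem_shiftSieveSet.mpr ⟨p, hp, hpx, rfl⟩

/-- `𝒜'_h(x) ⊆ (0, x + h]`. [folklore] -/
theorem shiftSieveSet'_subset_Ioc (h x : ℕ) : shiftSieveSet' h x ⊆ Finset.Ioc 0 (x + h) :=
  (shiftSieveSet'_subset h x).trans (shiftSieveSet_subset_Ioc h x)

/-- A prime `q ∣ h` divides no element of `𝒜'_h(x)` when `h ≠ 0` (`q ∣ p + h` would give `q = p ≤ h`).
[folklore] -/
theorem not_dvd_of_mem_shiftSieveSet' {h x n q : ℕ} (hh0 : h ≠ 0) (hq : q.Prime) (hqh : q ∣ h)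
    (hn : n ∈ shiftSieveSet' h x) : ¬ q ∣ n := by
  obtain ⟨p, hp, hhp, -, rfl⟩ := mem_shiftSieveSet'.mp hn
  intro hqn
  have hqp : q ∣ p := (Nat.dvd_add_left hqh).mp hqn
  have hqp' : q = p := (Nat.prime_dvd_prime_iff_eq hq hp).mp hqp
  have : q ≤ h := Nat.le_of_dvd (Nat.pos_of_ne_zero hh0) hqh
  omega

/-- `roughCount` is monotone in the set. [folklore] -/
theorem roughCount_mono {A B : Finset ℕ} (hAB : A ⊆ B) (z : ℕ) : roughCount A z ≤ roughCount B z := by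
  rw [roughCount, roughCount]
  exact Finset.card_le_card (Finset.monotone_filter_left _ hAB)

/-! ### The sifted sequence -/

/-- The weights `a(n) = 1_{𝒜'_h(x)}(n)`. [folklore] -/
def chenShiftWeight (h x n : ℕ) : ℝ :=
  if n ∈ shiftSieveSet' h x then 1 else 0

/-- `0 ≤ a(n)`. [folklore] -/
theorem chenShiftWeight_nonneg (h x n : ℕ) : 0 ≤ chenShiftWeight h x n := by
  unfold chenShiftWeight; split_ifs <;> norm_num

/-- **The shifted sifted sequence** `𝒜'_h(x) = {p + h : h < p ≤ x}`: weights `1_{𝒜'}`, density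
`g = shiftedPrimesDensity h` (`g(d) = 1/φ(d)` for `(d, h) = 1`, `0` otherwise), size `X = π(x)`
(the analogue of `chenGoldbachSeq` for `x − p ↦ p + h`). [cite: Nathanson1996, §10.3–10.4] -/
def chenShiftSeq (h x : ℕ) : SieveSequence where
  a := chenShiftWeight h x
  a_nonneg := chenShiftWeight_nonneg h x
  size := fun _ => (Nat.primeCounting x : ℝ)
  density := shiftedPrimesDensity h
  density_mult := isMultiplicative_shiftedPrimesDensity h

/-- `∑_{n ∈ s} a(n) = #(s ∩ 𝒜'_h(x))`. [folklore] -/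
theorem sum_chenShiftWeight (h x : ℕ) (s : Finset ℕ) :
    ∑ n ∈ s, chenShiftWeight h x n = #(s.filter fun n => n ∈ shiftSieveSet' h x) := by
  classical
  rw [Finset.card_filter, Nat.cast_sum]
  refine Finset.sum_congr rfl fun n _ => ?_
  unfold chenShiftWeight
  split_ifs <;> simp

/-- **`S(𝒜', P(z); x + h) = S(𝒜'_h(x), ⌈z⌉)`** (`roughCount`): sifting by all primes `< z` keeps the
elements with no prime factor `< z`. [cite: Nathanson1996, (10.6)] -/
theorem sifted_chenShiftSeq (h x : ℕ) (z : ℝ) :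
    (chenShiftSeq h x).sifted ((x + h : ℕ) : ℝ) (primesProdBelow z) = roughCount (shiftSieveSet' h x) ⌈z⌉₊ := by
  classical
  change ∑ n ∈ (Finset.Ioc 0 ⌊((x + h : ℕ) : ℝ)⌋₊).filter (fun n : ℕ => n.Coprime (primesProdBelow z)),
    chenShiftWeight h x n = _
  rw [sum_chenShiftWeight, roughCount, Finset.filter_filter, Nat.floor_natCast]
  congr 2
  ext n
  rw [Finset.mem_filter, Finset.mem_filter]
  constructor
  · rintro ⟨hn0, hcop, hn⟩
    have hn0' : n ≠ 0 := by have := (Finset.mem_Ioc.mp hn0).1; omega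
    exact ⟨hn, (coprime_primesProdBelow_iff_isRough hn0').mp hcop⟩
  · rintro ⟨hn, hr⟩
    have hnI := shiftSieveSet'_subset_Ioc h x hn
    have hn0' : n ≠ 0 := by have := (Finset.mem_Ioc.mp hnI).1; omega
    exact ⟨hnI, (coprime_primesProdBelow_iff_isRough hn0').mpr hr, hn⟩

/-- **`V(P(z)) = V_h(z)`**: `∏_{p < z} (1 − g(p)) = ∏_{p < z, p ∤ h} (1 − 1/(p − 1)) = sieveProduct h z`.
[cite: Nathanson1996, (10.8)] -/
theorem densityProduct_chenShiftSeq (h x : ℕ) (z : ℝ) :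
    (chenShiftSeq h x).densityProduct (primesProdBelow z) = sieveProduct h z := by
  rw [SieveSequence.densityProduct, primeFactors_primesProdBelow, sieveProduct, Finset.prod_filter]
  refine Finset.prod_congr rfl fun p hp => ?_
  have hp : p.Prime := Nat.prime_of_mem_primesBelow hp
  change 1 - shiftedPrimesDensity h p = _
  rw [shiftedPrimesDensity_apply]
  by_cases hdvd : p ∣ h
  · have : ¬ (p.Coprime h ∧ p ≠ 0) := fun hc => (Nat.Prime.coprime_iff_not_dvd hp).mp hc.1 hdvd
    rw [if_neg this, if_neg (not_not.mpr hdvd), sub_zero]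
  · rw [if_pos ⟨(Nat.Prime.coprime_iff_not_dvd hp).mpr hdvd, hp.ne_zero⟩, if_pos hdvd,
      Nat.totient_prime hp, Nat.cast_sub hp.one_le, Nat.cast_one, one_div]

/-- The size is `π(x)` at every height. [folklore] -/
theorem size_chenShiftSeq (h x : ℕ) (t : ℝ) : (chenShiftSeq h x).size t = Nat.primeCounting x := rfl

/-- **Dimension `Ω(1, L₀)`** for even `h`, with the absolute `L₀ = dimConst` of `ChenSiftedLower`
(the density is that of `chenGoldbachSeq h`: `hasIwaniecDimension_chenGoldbachSeq`).
[cite: Nathanson1996, §10.3 (9.33)–(9.34)] -/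
theorem hasIwaniecDimension_chenShiftSeq {h : ℕ} (hh : Even h) (x : ℕ) :
    HasIwaniecDimension (chenShiftSeq h x).density 1 dimConst :=
  hasIwaniecDimension_chenGoldbachSeq (N := h) hh

/-! ### The remainders `r(d) = |𝒜'_d| − π(x)/φ(d)` -/

/-- `|𝒜'_d| = #{h < p ≤ x prime : d ∣ p + h}`. [cite: Nathanson1996, (10.9)] -/
theorem congrSum_chenShiftSeq (h x d : ℕ) :
    (chenShiftSeq h x).congrSum d ((x + h : ℕ) : ℝ) =
      #((Finset.Ioc h x).filter fun p => p.Prime ∧ d ∣ p + h) := by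
  classical
  change ∑ n ∈ (Finset.Ioc 0 ⌊((x + h : ℕ) : ℝ)⌋₊).filter (d ∣ ·), chenShiftWeight h x n = _
  rw [sum_chenShiftWeight, Finset.filter_filter, Nat.floor_natCast]
  have h1 : (Finset.Ioc 0 (x + h)).filter (fun n => d ∣ n ∧ n ∈ shiftSieveSet' h x) =
      ((Finset.Ioc h x).filter fun p => p.Prime ∧ d ∣ p + h).map (addRightEmbedding h) := by
    ext n
    rw [Finset.mem_filter, Finset.mem_map]
    constructor
    · rintro ⟨-, hdn, hn⟩
      obtain ⟨p, hp, hhp, hpx, rfl⟩ := mem_shiftSieveSet'.mp hn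
      exact ⟨p, Finset.mem_filter.mpr ⟨Finset.mem_Ioc.mpr ⟨hhp, hpx⟩, hp, hdn⟩, rfl⟩
    · rintro ⟨p, hp, rfl⟩
      rw [Finset.mem_filter, Finset.mem_Ioc] at hp
      obtain ⟨⟨hhp, hpx⟩, hp, hdvd⟩ := hp
      have hmem : p + h ∈ shiftSieveSet' h x := mem_shiftSieveSet'.mpr ⟨p, hp, hhp, hpx, rfl⟩
      exact ⟨shiftSieveSet'_subset_Ioc h x hmem, hdvd, hmem⟩
  rw [h1, Finset.card_map]

/-- A choice of the residue `−h (mod q)` as a unit of `ℤ/qℤ` when `(h, q) = 1` (junk `1` otherwise).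
[folklore] -/
def negResUnit (h q : ℕ) : (ZMod q)ˣ :=
  if hc : h.Coprime q then -ZMod.unitOfCoprime h hc else 1

/-- For `(h, q) = 1`, `negResUnit h q` is the class of `−h`. [folklore] -/
theorem coe_negResUnit {h q : ℕ} (hc : h.Coprime q) :
    ((negResUnit h q : (ZMod q)ˣ) : ZMod q) = -(h : ZMod q) := by
  rw [negResUnit, dif_pos hc, Units.val_neg, ZMod.coe_unitOfCoprime]

/-- `p ≡ −h (mod d)` iff `d ∣ p + h`. [folklore] -/
theorem natCast_eq_neg_iff_dvd (d p h : ℕ) : ((p : ℕ) : ZMod d) = -(h : ZMod d) ↔ d ∣ p + h := by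
  rw [eq_neg_iff_add_eq_zero, ← Nat.cast_add, ZMod.natCast_eq_zero_iff]

/-- **The remainder of the shifted sequence**: for `h ≠ 0` and `d ≠ 0`,
`|r(d)| ≤ |π(x; d, −h) − π(x)/φ(d)| + (h + 1)` — for `(d, h) = 1`,
`|𝒜'_d| = π(x; d, −h) − #{p ≤ h : p ≡ −h (d)}`; for `(d, h) > 1` both `|𝒜'_d|` and `g(d)` vanish
(Nathanson p. 171 for `{N − p}`: `r(d) = δ(N; d, N) + O(log N)`).
[cite: Nathanson1996, §10.4 (proof of Thm 10.4)] -/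
theorem abs_remainder_chenShiftSeq_le {h x d : ℕ} (hh0 : h ≠ 0) (hd : d ≠ 0) :
    |(chenShiftSeq h x).remainder d ((x + h : ℕ) : ℝ)| ≤
      |primeCountingDisc d (negResUnit h d : ZMod d) x| + (h + 1) := by
  classical
  rw [SieveSequence.remainder, congrSum_chenShiftSeq]
  change |(#((Finset.Ioc h x).filter fun p => p.Prime ∧ d ∣ p + h) : ℝ) -
      shiftedPrimesDensity h d * (Nat.primeCounting x : ℝ)| ≤ _
  rw [shiftedPrimesDensity_apply]
  by_cases hcop : d.Coprime h
  · rw [if_pos ⟨hcop, hd⟩, primeCountingDisc_eq_card_sub, coe_negResUnit hcop.symm]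
    set C₁ := #((Finset.Ioc h x).filter fun p => p.Prime ∧ d ∣ p + h) with hC₁
    set C₂ := #{p ∈ range (x + 1) | p.Prime ∧ ((p : ℕ) : ZMod d) = -(h : ZMod d)} with hC₂
    have h12 : C₁ ≤ C₂ := by
      refine Finset.card_le_card fun p hp => ?_
      rw [Finset.mem_filter, Finset.mem_Ioc] at hp
      rw [Finset.mem_filter, Finset.mem_range]
      exact ⟨by omega, hp.2.1, (natCast_eq_neg_iff_dvd d p h).mpr hp.2.2⟩
    have h21 : C₂ ≤ C₁ + (h + 1) := by
      have hsub : (range (x + 1)).filter (fun p => p.Prime ∧ ((p : ℕ) : ZMod d) = -(h : ZMod d)) ⊆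
          ((Finset.Ioc h x).filter fun p => p.Prime ∧ d ∣ p + h) ∪ range (h + 1) := by
        intro p hp
        rw [Finset.mem_filter, Finset.mem_range] at hp
        rw [Finset.mem_union, Finset.mem_filter, Finset.mem_Ioc, Finset.mem_range]
        by_cases hph : h < p
        · exact Or.inl ⟨⟨hph, by omega⟩, hp.2.1, (natCast_eq_neg_iff_dvd d p h).mp hp.2.2⟩
        · exact Or.inr (by omega)
      calc C₂ ≤ #(((Finset.Ioc h x).filter fun p => p.Prime ∧ d ∣ p + h) ∪ range (h + 1)) :=
            Finset.card_le_card hsub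
        _ ≤ C₁ + #(range (h + 1)) := Finset.card_union_le _ _
        _ = C₁ + (h + 1) := by rw [Finset.card_range]
    have h12' : (C₁ : ℝ) ≤ C₂ := by exact_mod_cast h12
    have h21' : (C₂ : ℝ) ≤ C₁ + (h + 1) := by exact_mod_cast h21
    have hdiff : |(C₁ : ℝ) - C₂| ≤ h + 1 := abs_sub_le_iff.mpr ⟨by linarith, by linarith⟩
    have e : (C₁ : ℝ) - ((Nat.totient d : ℝ))⁻¹ * (Nat.primeCounting x : ℝ) =
        ((C₂ : ℝ) - (Nat.primeCounting x : ℝ) / Nat.totient d) + ((C₁ : ℝ) - C₂) := by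
      rw [div_eq_mul_inv]; ring
    rw [e]
    exact (abs_add_le _ _).trans (by linarith)
  · -- `(d, h) > 1`: a common prime factor `q` of `d` and `h` divides no element of `𝒜'`
    have hne : Nat.gcd d h ≠ 1 := hcop
    obtain ⟨q, hq, hqg⟩ := Nat.exists_prime_and_dvd hne
    have hqd : q ∣ d := hqg.trans (Nat.gcd_dvd_left d h)
    have hqh : q ∣ h := hqg.trans (Nat.gcd_dvd_right d h)
    have hempty : (Finset.Ioc h x).filter (fun p => p.Prime ∧ d ∣ p + h) = ∅ := by
      refine Finset.filter_eq_empty_iff.mpr fun p hp hc => ?_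
      rw [Finset.mem_Ioc] at hp
      have hmem : p + h ∈ shiftSieveSet' h x := mem_shiftSieveSet'.mpr ⟨p, hc.1, hp.1, hp.2, rfl⟩
      exact not_dvd_of_mem_shiftSieveSet' hh0 hq hqh hmem (hqd.trans hc.2)
    rw [hempty, if_neg fun hc => hcop hc.1, Finset.card_empty, Nat.cast_zero, zero_mul, sub_zero,
      abs_zero]
    positivity

/-- **The remainder sum is dominated by the Bombieri–Vinogradov sum**: for `h ≠ 0` and `D ≥ 0`,
`∑_{d < D, d ∣ P(z)} |r(d)| ≤ ∑_{d ≤ D} |δ(x; d, −h)| + D (h + 1)`.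
[cite: Nathanson1996, §10.4 (proof of Thm 10.4)] -/
theorem remainderSum_chenShiftSeq_le {h : ℕ} (hh0 : h ≠ 0) (x : ℕ) (z : ℝ) {D : ℝ} (hD : 0 ≤ D) :
    ∑ d ∈ (Finset.range ⌈D⌉₊).filter (· ∣ primesProdBelow z),
        |(chenShiftSeq h x).remainder d ((x + h : ℕ) : ℝ)| ≤
      (∑ d ∈ Icc 1 ⌊D⌋₊, |primeCountingDisc d (negResUnit h d : ZMod d) x|) + D * (h + 1) := by
  have hsub : (Finset.range ⌈D⌉₊).filter (· ∣ primesProdBelow z) ⊆ Icc 1 ⌊D⌋₊ := by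
    intro d hd
    rw [Finset.mem_filter, Finset.mem_range] at hd
    have hd0 : d ≠ 0 := fun h0 => primesProdBelow_ne_zero z (zero_dvd_iff.mp (h0 ▸ hd.2))
    rw [Finset.mem_Icc]
    exact ⟨Nat.pos_of_ne_zero hd0, Nat.le_floor (Nat.lt_ceil.mp hd.1).le⟩
  calc ∑ d ∈ (Finset.range ⌈D⌉₊).filter (· ∣ primesProdBelow z),
        |(chenShiftSeq h x).remainder d ((x + h : ℕ) : ℝ)|
      ≤ ∑ d ∈ (Finset.range ⌈D⌉₊).filter (· ∣ primesProdBelow z),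
          (|primeCountingDisc d (negResUnit h d : ZMod d) x| + (h + 1)) := by
        refine Finset.sum_le_sum fun d hd => ?_
        rw [Finset.mem_filter] at hd
        have hd0 : d ≠ 0 := fun h0 => primesProdBelow_ne_zero z (zero_dvd_iff.mp (h0 ▸ hd.2))
        exact abs_remainder_chenShiftSeq_le hh0 hd0
    _ ≤ ∑ d ∈ Icc 1 ⌊D⌋₊, (|primeCountingDisc d (negResUnit h d : ZMod d) x| + (h + 1)) :=
        Finset.sum_le_sum_of_subset_of_nonneg hsub fun d _ _ => by positivity
    _ = (∑ d ∈ Icc 1 ⌊D⌋₊, |primeCountingDisc d (negResUnit h d : ZMod d) x|) +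
          ⌊D⌋₊ * ((h : ℝ) + 1) := by
        rw [Finset.sum_add_distrib, Finset.sum_const, Nat.card_Icc, Nat.add_sub_cancel, nsmul_eq_mul]
    _ ≤ _ := by gcongr; exact Nat.floor_le hD

/-! ### From `𝒜'` back to `𝒜` -/

/-- `S(𝒜'_h(x), z) ≤ S(𝒜_h(x), z)`: a lower bound for the sifted subsequence is a lower bound for
`roughCount (shiftSieveSet h x)`, the quantity of hypothesis (A) of `ChenShiftedAssembly`. [folklore] -/
theorem roughCount_shiftSieveSet'_le (h x z : ℕ) :
    roughCount (shiftSieveSet' h x) z ≤ roughCount (shiftSieveSet h x) z :=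
  roughCount_mono (shiftSieveSet'_subset h x) z

end Literature.NumberTheory.Sieve.Chen
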